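/-
Copyright (c) 2026 the pub-hodgecm-mathlib formalisation cell (harness21).  Prover seat hodgecm-mathlib-K2E3-p21 (g6), Track B «K2-LIT» ∕ h413
(`stmt-HodgeConjecture-24833`), line `K2_E3_EllipticInputs`, road «GL₂-sc» (road owner K2E5-p17 (g5), ASSIGNMENTS 2026-09-04T09:19:45Z; dealer K2E3-plan (g4) D66;
BRICK LIST v1.1), add-on to brick (2E-a3) ★ `K2E3GL2HenselSplitCentralizer` (K2E5-p17 (g5)): the COLLISION-CURRENCY and COMPACT-CENTRALISER forms of its head.  2026-09-04.
-/
import Summits.HodgeConjecture.HodgeConjecture.Theorems.K2E3GL2HenselSplitCentralizer   -- ★ (2E-a3) p858905 (K2E5-p17 (g5)): `exists_simple_root_of_upper_small`, `exists_centralizer_unbounded_of_upper_small`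
import Summits.HodgeConjecture.HodgeConjecture.Theorems.K2E3GL2ModCentre                -- ★ (2F-a) p858726 (K2E5-p17 (g5)): `Ḡ = GL₂(F) ⧸ Z`, compactness criterion `exists_bound_of_isCompact_image`
import HarnessLib

/-!
# Crux `H413` — K2-LIT E3, road «GL₂-sc», add-on to brick (2E-a3): «HENSEL ⇒ SPLIT ⇒ UNBOUNDED CENTRALISER» in the road's COLLISION CURRENCY, and its
# contrapositive — a COMPACT centraliser modulo the centre forces `v((h₀₀ − h₁₁)²) < q^{−k}` for a near-Borel `h ∈ GL₂(F)`

Cell `hodgecm-mathlib`, Track B, line `K2_E3_EllipticInputs`, road «GL₂-sc» = Harish-Chandra's local integrability for supercuspidal `GL₂(F)` (letter (S-C′-GL₂sc) of the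
hosted leaf (nsc-S-C′); road owner K2E5-p17 (g5); BRICK LIST v1.1 `K2/K2E5-p17/g5/BRICKLIST-GL2sc-v1.1.K2E5-p17-g5.md`, elliptic half 2E-a = FC on `GL₂ ⧸ Z`).  ★ (2E-a3)
proves: `h ∈ GL₂(F)` with entries `≤ q^M`, `|h₀₁| ≤ q^{M−d}`, `|h₀₀ − h₁₁| ≥ q^{−k}`, `d ≥ 2M + 2k + 1` ⟹ `Z(h)` is unbounded modulo scalars.  This file (road owner's request
09:19:45Z) repackages it for the box count of (2E-a5) `K2E3GL2FinConj` (twin of ★ (GL-3b) `K2E3GL3FinConj.finConjGL` :305–:344).  THEOREMS ONLY; count-neutral helper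
(`--supports stmt-HodgeConjecture-24833 --as helper`); no `σ`, no measure.

* §1 THE LOWER SHAPE (`|h₁₀| ≤ q^{M−d}`): `exists_simple_root_of_lower_small`, `exists_centralizer_unbounded_of_lower_small` — ★ (2E-a3) for `hᵀ` (same characteristic
  polynomial, Mathlib `Matrix.charpoly_transpose`) and ★ (2E-a2).
* §2 COLLISION CURRENCY: `exp_neg_le_v_of_le_v_sq` (`exp(−k) ≤ v(x²)`, `v x ≤ q^M` ⟹ `exp(−(k+M)) ≤ v x`) and `exists_centralizer_unbounded_of_diffSq_separated` — ★ (2E-a3)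
  with the separation stated on the COLLISION QUADRATIC `Q(h) = (h₀₀ − h₁₁)²` of ★ (2E-a1) §4 ∕ ★ (2E-a4) (`exp(−k) ≤ v(Q(h))`, `d ≥ 4M + 2k + 1`).
* §3 THE CONTRAPOSITIVE: `not_unbounded_of_isCompact_centralizer` (★ (2F-a) `exists_bound_of_isCompact_image` at `X̄ = Z_Ḡ(h̄)`: a compact centraliser mod centre is
  bounded in the scale-invariant sizes `v(y_{ij})·v(y⁻¹_{i′j′})`), **`v_diffSq_lt_of_isCompact_centralizer`** (compact `Z_Ḡ(h̄)` + near-Borel shape + `d ≥ 4M + 2k + 1` ⟹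
  `v((h₀₀ − h₁₁)²) < exp(−k)`) and `v_diag_sub_lt_of_isCompact_centralizer` (`d ≥ 2M + 2k + 1` ⟹ `v(h₀₀ − h₁₁) < exp(−k)`) — the `hcent`∕`hQ` block of ★ (GL-3b)
  pre-assembled at `N = 2`.

HONEST LABEL: HC_CM is proved only modulo the 7 printed citations (2 remaining named inputs: hLiu418 = stmt-HodgeConjecture-24832, h413 =
stmt-HodgeConjecture-24833) until rung 0 closes; elementary, closes no organ by itself.

## References
* [HarishChandra1970] Harish-Chandra (notes by G. van Dijk), *Harmonic Analysis on Reductive p-adic Groups*, LNM 162 (1970), Part VI §8 p. 60 (compact centralisers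
  of elliptic elements; a split element has non-compact centraliser modulo the centre), Part VII §2 p. 69 (near-singular boxes).
* [Cartier1979] P. Cartier, *Representations of p-adic groups: a survey*, Proc. Sympos. Pure Math. 33.1 (1979), §I.3–I.4 (compactness modulo the centre).
* [NeukirchANT1999] J. Neukirch, *Algebraic Number Theory* (1999), Ch. II §4 Lemma (4.6) (Hensel's lemma, strong form).
-/

set_option autoImplicit false
-- the mandated namespace repeats `HodgeConjecture.HodgeConjecture`, as in every `Theorems/*.lean` of this sub-problem
set_option linter.dupNamespace false

noncomputable section

open Polynomial Matrix
open scoped WithZero ValuativeRel MatrixGroups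
open Literature.NumberTheory.Automorphic
open Literature.NumberTheory.GaloisRepresentations Literature.NumberTheory.GaloisRepresentations.IsNonarchimedeanLocalField
open Summit.HodgeConjecture.HodgeConjecture.Cruxes.H413.K2E3GL2SpectralIdempotentCentralizer
open Summit.HodgeConjecture.HodgeConjecture.Cruxes.H413.K2E3GL2HenselSplitCentralizer
open Summit.HodgeConjecture.HodgeConjecture.Cruxes.H413.K2E3GL2ModCentre

namespace Summit.HodgeConjecture.HodgeConjecture.Cruxes.H413.K2E3GL2HenselSplitCentralizerCompact

variable {F : Type*} [Field F] [Valued F ℤᵐ⁰] [ValuativeRel F] [(Valued.v : Valuation F ℤᵐ⁰).Compatible] [IsNonarchimedeanLocalField F]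

/-! ## §1  The lower shape (`h₁₀` small): ★ (2E-a3) for the transpose -/

/-- **HENSEL (lower entry small)**: `g ∈ 𝔤𝔩₂(F)` with entries `≤ q^M`, `|g₁₀| ≤ q^{M−d}`, `|g₀₀ − g₁₁| ≥ q^{−k}`, `d ≥ 2M + 2k + 1` ⟹ `χ_g` has a simple rational root
— ★ (2E-a3) `exists_simple_root_of_upper_small` for `gᵀ`, which has the same characteristic polynomial. [cite: NeukirchANT1999, Ch. II §4 Lemma (4.6)] -/
theorem exists_simple_root_of_lower_small (g : Matrix (Fin 2) (Fin 2) F) {M k d : ℕ} (hd : 2 * M + 2 * k + 1 ≤ d)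
    (hall : ∀ i j, Valued.v (g i j) ≤ WithZero.exp (M : ℤ))
    (h10 : Valued.v (g 1 0) ≤ WithZero.exp ((M : ℤ) - d))
    (hsep : WithZero.exp (-(k : ℤ)) ≤ Valued.v (g 0 0 - g 1 1)) :
    ∃ l₀ : F, g.charpoly.IsRoot l₀ ∧ g.charpoly.derivative.eval l₀ ≠ 0 := by
  obtain ⟨l₀, h1, h2⟩ := exists_simple_root_of_upper_small gᵀ hd (fun i j => by simpa using hall j i) (by simpa using h10) (by simpa using hsep)
  exact ⟨l₀, by rwa [Matrix.charpoly_transpose] at h1, by rwa [Matrix.charpoly_transpose] at h2⟩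

/-- **(2E-a3), LOWER SHAPE**: `h ∈ GL₂(F)` with entries `≤ q^M`, `|h₁₀| ≤ q^{M−d}`, `|h₀₀ − h₁₁| ≥ q^{−k}`, `d ≥ 2M + 2k + 1` ⟹ the centraliser of `h` is unbounded modulo scalars
(simple rational eigenvalue §1 ⇒ non-trivial spectral idempotent in `Z(h)` ⇒ unbounded pencil, ★ (2E-a2); `h` is not scalar because `h₀₀ ≠ h₁₁`).
[cite: HarishChandra1970, Part VI §8 p. 60] -/
theorem exists_centralizer_unbounded_of_lower_small {ϖ : F} (hϖ : Valued.v ϖ = WithZero.exp (-1 : ℤ)) {M k d : ℕ} (hd : 2 * M + 2 * k + 1 ≤ d)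
    (h : GL (Fin 2) F) (hall : ∀ i j, Valued.v ((h : Matrix (Fin 2) (Fin 2) F) i j) ≤ WithZero.exp (M : ℤ))
    (h10 : Valued.v ((h : Matrix (Fin 2) (Fin 2) F) 1 0) ≤ WithZero.exp ((M : ℤ) - d))
    (hsep : WithZero.exp (-(k : ℤ)) ≤ Valued.v ((h : Matrix (Fin 2) (Fin 2) F) 0 0 - (h : Matrix (Fin 2) (Fin 2) F) 1 1)) :
    ∀ N : ℕ, ∃ y : GL (Fin 2) F, y * h = h * y ∧ ∃ i j i' j' : Fin 2,
      WithZero.exp (N : ℤ) < Valued.v ((y : Matrix (Fin 2) (Fin 2) F) i j) * Valued.v (((y⁻¹ : GL (Fin 2) F) : Matrix (Fin 2) (Fin 2) F) i' j') := by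
  intro N
  obtain ⟨l₀, hroot, hsimple⟩ := exists_simple_root_of_lower_small (h : Matrix (Fin 2) (Fin 2) F) hd hall h10 hsep
  obtain ⟨e, he, hhe, he0, he1⟩ := exists_idempotent_of_simple_root (h : Matrix (Fin 2) (Fin 2) F) hroot hsimple
  refine exists_centralizer_unbounded_of_idempotent hϖ h he hhe he0 (fun h1 => ?_) N
  have hscal := he1 h1
  have hq : (h : Matrix (Fin 2) (Fin 2) F) 0 0 - (h : Matrix (Fin 2) (Fin 2) F) 1 1 = 0 := by
    rw [hscal]; simp [Matrix.algebraMap_matrix_apply]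
  rw [hq, map_zero] at hsep
  exact absurd hsep (not_le.2 WithZero.exp_pos)

/-! ## §2  The collision currency `Q(h) = (h₀₀ − h₁₁)²` -/

omit [ValuativeRel F] [(Valued.v : Valuation F ℤᵐ⁰).Compatible] [IsNonarchimedeanLocalField F] in
/-- `exp(−k) ≤ v(x²)` and `v x ≤ q^M` give `exp(−(k + M)) ≤ v x`. [folklore] -/
theorem exp_neg_le_v_of_le_v_sq {x : F} {M k : ℕ} (hx : Valued.v x ≤ WithZero.exp (M : ℤ)) (hsq : WithZero.exp (-(k : ℤ)) ≤ Valued.v (x ^ 2)) :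
    WithZero.exp (-(((k + M : ℕ)) : ℤ)) ≤ Valued.v x := by
  rw [map_pow, pow_two] at hsq
  calc WithZero.exp (-(((k + M : ℕ)) : ℤ)) = WithZero.exp (-(k : ℤ)) * WithZero.exp (-(M : ℤ)) := by
        rw [← WithZero.exp_add]; congr 1; push_cast; ring
    _ ≤ Valued.v x * Valued.v x * WithZero.exp (-(M : ℤ)) := mul_le_mul' hsq le_rfl
    _ ≤ Valued.v x * WithZero.exp (M : ℤ) * WithZero.exp (-(M : ℤ)) := mul_le_mul' (mul_le_mul' le_rfl hx) le_rfl
    _ = Valued.v x := by rw [mul_assoc, ← WithZero.exp_add, add_neg_cancel, WithZero.exp_zero, mul_one]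

/-- **(2E-a3) IN THE COLLISION CURRENCY.**  `h ∈ GL₂(F)` with entries `≤ q^M`, `|h₀₁| ≤ q^{M−d}`, `exp(−k) ≤ v(Q(h))` for the collision quadratic `Q(h) = (h₀₀ − h₁₁)²` of
★ (2E-a1) §4 ∕ ★ (2E-a4), and `d ≥ 4M + 2k + 1` ⟹ the centraliser of `h` is unbounded modulo scalars (★ (2E-a3) with `k + M`, since `v(h₀₀ − h₁₁) ≤ q^M`).
[cite: HarishChandra1970, Part VI §8 p. 60] -/
theorem exists_centralizer_unbounded_of_diffSq_separated {ϖ : F} (hϖ : Valued.v ϖ = WithZero.exp (-1 : ℤ)) {M k d : ℕ} (hd : 4 * M + 2 * k + 1 ≤ d)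
    (h : GL (Fin 2) F) (hall : ∀ i j, Valued.v ((h : Matrix (Fin 2) (Fin 2) F) i j) ≤ WithZero.exp (M : ℤ))
    (h01 : Valued.v ((h : Matrix (Fin 2) (Fin 2) F) 0 1) ≤ WithZero.exp ((M : ℤ) - d))
    (hsep : WithZero.exp (-(k : ℤ)) ≤ Valued.v (((h : Matrix (Fin 2) (Fin 2) F) 0 0 - (h : Matrix (Fin 2) (Fin 2) F) 1 1) ^ 2)) :
    ∀ N : ℕ, ∃ y : GL (Fin 2) F, y * h = h * y ∧ ∃ i j i' j' : Fin 2,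
      WithZero.exp (N : ℤ) < Valued.v ((y : Matrix (Fin 2) (Fin 2) F) i j) * Valued.v (((y⁻¹ : GL (Fin 2) F) : Matrix (Fin 2) (Fin 2) F) i' j') := by
  have hle : Valued.v ((h : Matrix (Fin 2) (Fin 2) F) 0 0 - (h : Matrix (Fin 2) (Fin 2) F) 1 1) ≤ WithZero.exp (M : ℤ) :=
    Valued.v.map_sub_le (hall 0 0) (hall 1 1)
  exact exists_centralizer_unbounded_of_upper_small hϖ (k := k + M) (by omega) h hall h01 (exp_neg_le_v_of_le_v_sq hle hsep)

/-! ## §3  The contrapositive: compact centraliser modulo the centre ⇒ collision -/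

omit [(Valued.v : Valuation F ℤᵐ⁰).Compatible] in
/-- **COMPACT CENTRALISER ⇒ BOUNDED CENTRALISER** (★ (2F-a) `exists_bound_of_isCompact_image` at `X̄ = Z_Ḡ(h̄)`): if the centraliser of `h̄` in `Ḡ = GL₂(F) ⧸ Z` is compact,
the scale-invariant sizes `v(y_{ij})·v(y⁻¹_{i′j′})` are NOT unbounded on `Z(h)`. [cite: Cartier1979, §I.3–I.4] [cite: HarishChandra1970, Part VI §8 p. 60] -/
theorem not_unbounded_of_isCompact_centralizer {ϖ : F} (hϖ : Valued.v ϖ = WithZero.exp (-1 : ℤ)) (h : GL (Fin 2) F)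
    (hZ : IsCompact ((Subgroup.centralizer ({(QuotientGroup.mk h : GL (Fin 2) F ⧸ Subgroup.center (GL (Fin 2) F))} :
      Set (GL (Fin 2) F ⧸ Subgroup.center (GL (Fin 2) F)))) : Set (GL (Fin 2) F ⧸ Subgroup.center (GL (Fin 2) F)))) :
    ¬ ∀ N : ℕ, ∃ y : GL (Fin 2) F, y * h = h * y ∧ ∃ i j i' j' : Fin 2,
      WithZero.exp (N : ℤ) < Valued.v ((y : Matrix (Fin 2) (Fin 2) F) i j) * Valued.v (((y⁻¹ : GL (Fin 2) F) : Matrix (Fin 2) (Fin 2) F) i' j') := by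
  intro hall'
  obtain ⟨N₁, hN₁⟩ := exists_bound_of_isCompact_image hϖ hZ
  obtain ⟨y, hyh, i, j, i', j', hlt⟩ := hall' (2 * N₁)
  have hy : (QuotientGroup.mk y : GL (Fin 2) F ⧸ Subgroup.center (GL (Fin 2) F)) ∈
      ((Subgroup.centralizer ({(QuotientGroup.mk h : GL (Fin 2) F ⧸ Subgroup.center (GL (Fin 2) F))} : Set (GL (Fin 2) F ⧸ Subgroup.center (GL (Fin 2) F)))) :
        Set (GL (Fin 2) F ⧸ Subgroup.center (GL (Fin 2) F))) := by
    rw [SetLike.mem_coe, Subgroup.mem_centralizer_singleton_iff, ← QuotientGroup.mk_mul, ← QuotientGroup.mk_mul, hyh]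
  have hle := hN₁ y hy i j i' j'
  rw [Nat.cast_mul, Nat.cast_ofNat] at hlt
  exact absurd (hlt.trans_le hle) (lt_irrefl _)

/-- **(2E-a3) CONTRAPOSITIVE, COLLISION CURRENCY.**  If `h ∈ GL₂(F)` has entries `≤ q^M`, `|h₀₁| ≤ q^{M−d}`, `d ≥ 4M + 2k + 1`, and the centraliser of `h̄` in
`Ḡ = GL₂(F) ⧸ Z` is COMPACT, then `v((h₀₀ − h₁₁)²) < exp(−k)` — the `hcent`∕`hQ` step of ★ (GL-3b) `finConjGL`, for (2E-a5) `K2E3GL2FinConj`.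
[cite: HarishChandra1970, Part VII §2 p. 69] [cite: Cartier1979, §I.3–I.4] -/
theorem v_diffSq_lt_of_isCompact_centralizer {ϖ : F} (hϖ : Valued.v ϖ = WithZero.exp (-1 : ℤ)) {M k d : ℕ} (hd : 4 * M + 2 * k + 1 ≤ d)
    (h : GL (Fin 2) F) (hall : ∀ i j, Valued.v ((h : Matrix (Fin 2) (Fin 2) F) i j) ≤ WithZero.exp (M : ℤ))
    (h01 : Valued.v ((h : Matrix (Fin 2) (Fin 2) F) 0 1) ≤ WithZero.exp ((M : ℤ) - d))
    (hZ : IsCompact ((Subgroup.centralizer ({(QuotientGroup.mk h : GL (Fin 2) F ⧸ Subgroup.center (GL (Fin 2) F))} :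
      Set (GL (Fin 2) F ⧸ Subgroup.center (GL (Fin 2) F)))) : Set (GL (Fin 2) F ⧸ Subgroup.center (GL (Fin 2) F)))) :
    Valued.v (((h : Matrix (Fin 2) (Fin 2) F) 0 0 - (h : Matrix (Fin 2) (Fin 2) F) 1 1) ^ 2) < WithZero.exp (-(k : ℤ)) := by
  by_contra hcon
  exact not_unbounded_of_isCompact_centralizer hϖ h hZ (exists_centralizer_unbounded_of_diffSq_separated hϖ hd h hall h01 (not_lt.1 hcon))

/-- **(2E-a3) CONTRAPOSITIVE, diagonal-difference form**: compact `Z_Ḡ(h̄)`, `|h₀₁| ≤ q^{M−d}` and `d ≥ 2M + 2k + 1` give `v(h₀₀ − h₁₁) < exp(−k)`.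
[cite: HarishChandra1970, Part VII §2 p. 69] -/
theorem v_diag_sub_lt_of_isCompact_centralizer {ϖ : F} (hϖ : Valued.v ϖ = WithZero.exp (-1 : ℤ)) {M k d : ℕ} (hd : 2 * M + 2 * k + 1 ≤ d)
    (h : GL (Fin 2) F) (hall : ∀ i j, Valued.v ((h : Matrix (Fin 2) (Fin 2) F) i j) ≤ WithZero.exp (M : ℤ))
    (h01 : Valued.v ((h : Matrix (Fin 2) (Fin 2) F) 0 1) ≤ WithZero.exp ((M : ℤ) - d))
    (hZ : IsCompact ((Subgroup.centralizer ({(QuotientGroup.mk h : GL (Fin 2) F ⧸ Subgroup.center (GL (Fin 2) F))} :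
      Set (GL (Fin 2) F ⧸ Subgroup.center (GL (Fin 2) F)))) : Set (GL (Fin 2) F ⧸ Subgroup.center (GL (Fin 2) F)))) :
    Valued.v ((h : Matrix (Fin 2) (Fin 2) F) 0 0 - (h : Matrix (Fin 2) (Fin 2) F) 1 1) < WithZero.exp (-(k : ℤ)) := by
  by_contra hcon
  exact not_unbounded_of_isCompact_centralizer hϖ h hZ (exists_centralizer_unbounded_of_upper_small hϖ hd h hall h01 (not_lt.1 hcon))

/-- **(2E-a3) CONTRAPOSITIVE, LOWER SHAPE**: compact `Z_Ḡ(h̄)`, `|h₁₀| ≤ q^{M−d}` and `d ≥ 2M + 2k + 1` give `v(h₀₀ − h₁₁) < exp(−k)`.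
[cite: HarishChandra1970, Part VII §2 p. 69] -/
theorem v_diag_sub_lt_of_isCompact_centralizer' {ϖ : F} (hϖ : Valued.v ϖ = WithZero.exp (-1 : ℤ)) {M k d : ℕ} (hd : 2 * M + 2 * k + 1 ≤ d)
    (h : GL (Fin 2) F) (hall : ∀ i j, Valued.v ((h : Matrix (Fin 2) (Fin 2) F) i j) ≤ WithZero.exp (M : ℤ))
    (h10 : Valued.v ((h : Matrix (Fin 2) (Fin 2) F) 1 0) ≤ WithZero.exp ((M : ℤ) - d))
    (hZ : IsCompact ((Subgroup.centralizer ({(QuotientGroup.mk h : GL (Fin 2) F ⧸ Subgroup.center (GL (Fin 2) F))} :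
      Set (GL (Fin 2) F ⧸ Subgroup.center (GL (Fin 2) F)))) : Set (GL (Fin 2) F ⧸ Subgroup.center (GL (Fin 2) F)))) :
    Valued.v ((h : Matrix (Fin 2) (Fin 2) F) 0 0 - (h : Matrix (Fin 2) (Fin 2) F) 1 1) < WithZero.exp (-(k : ℤ)) := by
  by_contra hcon
  exact not_unbounded_of_isCompact_centralizer hϖ h hZ (exists_centralizer_unbounded_of_lower_small hϖ hd h hall h10 (not_lt.1 hcon))

end Summit.HodgeConjecture.HodgeConjecture.Cruxes.H413.K2E3GL2HenselSplitCentralizerCompact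

end
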